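import Mathlib
import Summits.Ventures.PercRepro2.TB14Slide
import Summits.Ventures.PercRepro2.TB14SlideKernels

/-!
# The mark slides along a degree-two vertex at its own root — modulo typed BHK 1.3
(blind cell PercRepro2, mine-c g17, 2026-08-25; `proofs/MINEC-TB14BLOCK.md` Theorem L)

Let the mark `b` have exactly two edges `e₁ = b a₁` (to ITS root) and `e₂ = b x`, both free.
Splitting the two-copy count of the folded kernel on the colours of `(e₁, e₂)`:
* both closed in the first copy: `b` is isolated there, the kernel vanishes;
* `e₁` closed, `e₂` open: `b` is a leaf at `x` in the first copy and a leaf at `a₁` in the second —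
  the kernel is the folded kernel of the mark `x` on `G − b`;
* `e₁` open, `e₂` closed: `b ∈ C_y(a₁)` always and `b` is a spectator leaf in both copies — the kernel
  is the ANTISYMMETRIC `foldK0 = 1_Q(y) 1_Q(w) (1[o ∈ C_w(a₂)] − 1[o ∈ C_y(a₂)])`, whose count is `0`;
* both open: the open path `a₁ – b – x` makes `1_Q(y) = 1_Q(y₂) · 1[x ∉ C_{y₂}(a₂)]`, so the kernel is
  `foldK0 + foldK13`, where `foldK13 = 1_Q(y) 1_Q(w) 1[x ∈ C_y(a₂)] (1[o ∈ C_y(a₂)] − 1[o ∈ C_w(a₂)])`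
  is the typed BHK 1.3 kernel of the root `a₂` (avoiding `a₁`) for the single-vertex events
  `{x ∈ C₂}`, `{o ∈ C₂}`: its two-copy count is `N(Q ∩ A ∩ A', Q) − N(Q ∩ A, Q ∩ A')`.
Hence (`pairCount_foldK_slide_own`)

  `D(G; a₁, a₂, b, o) = D(G − b; a₁, a₂, x, o) + S₁₃(G − b; a₂; x, o)`

at every profile in which `e₁, e₂` are free: under `(TB13)_sv` the mark slides off its own root too.
Exact check `data/mine-c/g17/scripts/slide1.py` (60 / 60 instances, all three terms by an independent
brute force).  Own work; standard axioms.
-/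

namespace Summit.Ventures.PercRepro2

namespace TB14Cut

open CovForm A3InactiveTyped

section SlideOwn

variable {V : Type} {E : Type} [Fintype E] [DecidableEq E] {R : Type*} [Field R]

variable {ends : E → Sym2 V} {e₁ e₂ : E} {b x a₁ a₂ o : V}

omit [Fintype E] [DecidableEq E] in
/-- A configuration with the two edges at `b` open dominates the one with them closed. -/
lemma le_of_path {y y₂ : Config E} (h₁ : ends e₁ = s(b, a₁)) (h₂ : ends e₂ = s(b, x))
    (hy : ∀ f, f ≠ e₁ → f ≠ e₂ → y f = y₂ f) (hb₂ : ∀ f, b ∈ ends f → y₂ f = false) : y₂ ≤ y := by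
  intro f
  by_cases hf₁ : f = e₁
  · subst hf₁; rw [hb₂ f (by rw [h₁]; exact Sym2.mem_mk_left _ _)]; exact Bool.false_le _
  by_cases hf₂ : f = e₂
  · subst hf₂; rw [hb₂ f (by rw [h₂]; exact Sym2.mem_mk_left _ _)]; exact Bool.false_le _
  · rw [hy f hf₁ hf₂]

omit [Fintype E] [DecidableEq E] in
/-- With the open path `a₁ – b – x` (the only open edges at `b`), `a₁ ↔ t` iff `a₁ ↔ t` or
`x ↔ t` without them (for `t ≠ b`). -/
lemma conn_root_path {y y₂ : Config E} (h₁ : ends e₁ = s(b, a₁)) (h₂ : ends e₂ = s(b, x))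
    (hy₁ : y e₁ = true) (hy₂ : y e₂ = true)
    (hy : ∀ f, f ≠ e₁ → f ≠ e₂ → y f = y₂ f) (hb₂ : ∀ f, b ∈ ends f → y₂ f = false)
    {t : V} (ht : t ≠ b) :
    Conn ends y a₁ t ↔ Conn ends y₂ a₁ t ∨ Conn ends y₂ x t := by
  have hle : y₂ ≤ y := le_of_path h₁ h₂ hy hb₂
  have hab : Conn ends y a₁ b := conn_symm (conn_of_openAdj ⟨e₁, hy₁, h₁⟩)
  have hbx : Conn ends y b x := conn_of_openAdj ⟨e₂, hy₂, h₂⟩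
  constructor
  · intro hc
    have key : t ∈ {s | Conn ends y₂ a₁ s ∨ Conn ends y₂ x s ∨ s = b} := by
      refine mem_of_conn_of_closed (S := {s | Conn ends y₂ a₁ s ∨ Conn ends y₂ x s ∨ s = b}) ?_
        (Or.inl (conn_refl _ _ _)) hc
      intro s hs s' hss'
      obtain ⟨_, f, hf, hends⟩ := openGraph_adj.1 hss'
      by_cases hf₁ : f = e₁
      · subst hf₁
        rw [h₁, Sym2.eq_iff] at hends
        rcases hends with ⟨_, rfl⟩ | ⟨rfl, _⟩
        · exact Or.inl (conn_refl _ _ _)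
        · exact Or.inr (Or.inr rfl)
      by_cases hf₂ : f = e₂
      · subst hf₂
        rw [h₂, Sym2.eq_iff] at hends
        rcases hends with ⟨_, rfl⟩ | ⟨rfl, _⟩
        · exact Or.inr (Or.inl (conn_refl _ _ _))
        · exact Or.inr (Or.inr rfl)
      · have hf' : y₂ f = true := by rw [← hy f hf₁ hf₂]; exact hf
        have hbf : b ∉ ends f := fun hbf => by
          have := hb₂ f hbf
          rw [this] at hf'
          exact Bool.false_ne_true hf'
        have hs_ne : s ≠ b := fun h => hbf (by rw [hends, h]; exact Sym2.mem_mk_left _ _)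
        rcases hs with hs | hs | hs
        · exact Or.inl (conn_trans hs (conn_of_openAdj ⟨f, hf', hends⟩))
        · exact Or.inr (Or.inl (conn_trans hs (conn_of_openAdj ⟨f, hf', hends⟩)))
        · exact absurd hs hs_ne
    rcases key with hk | hk | hk
    · exact Or.inl hk
    · exact Or.inr hk
    · exact absurd hk ht
  · rintro (hc | hc)
    · exact conn_mono hle hc
    · exact conn_trans (conn_trans hab hbx) (conn_mono hle hc)

omit [Fintype E] [DecidableEq E] in
/-- With the open path `a₁ – b – x` at `b` and `a₁ ↮ a₂`, the cluster of `a₂` does not see `b`: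
`a₂ ↔ t` iff `a₂ ↔ t` without the two edges (for `t ≠ b`). -/
lemma conn_other_root_path {y y₂ : Config E} (h₁ : ends e₁ = s(b, a₁)) (h₂ : ends e₂ = s(b, x))
    (hy₁ : y e₁ = true) (hy : ∀ f, f ≠ e₁ → f ≠ e₂ → y f = y₂ f)
    (hb₂ : ∀ f, b ∈ ends f → y₂ f = false) (hQ : ¬ Conn ends y a₁ a₂) (ha₂ : a₂ ≠ b)
    {t : V} (ht : t ≠ b) :
    Conn ends y a₂ t ↔ Conn ends y₂ a₂ t := by
  have hle : y₂ ≤ y := le_of_path h₁ h₂ hy hb₂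
  constructor
  · intro hc
    have key : t ∈ {s | Conn ends y₂ a₂ s} := by
      refine mem_of_conn_of_closed (S := {s | Conn ends y₂ a₂ s}) ?_ (conn_refl _ _ _) hc
      intro s hs s' hss'
      obtain ⟨_, f, hf, hends⟩ := openGraph_adj.1 hss'
      have hs_ne : s ≠ b := fun h => not_conn_isolated hb₂ ha₂ (h ▸ hs)
      have hs'_ne : s' ≠ b := fun h => by
        subst h
        have h1 : Conn ends y a₂ s' :=
          conn_trans (conn_mono hle hs) (conn_of_openAdj ⟨f, hf, hends⟩)
        have h2 : Conn ends y s' a₁ := conn_of_openAdj ⟨e₁, hy₁, h₁⟩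
        exact hQ (conn_symm (conn_trans h1 h2))
      have hbf : b ∉ ends f := fun hbf => by
        rw [hends] at hbf
        rcases Sym2.mem_iff.1 hbf with h | h
        · exact hs_ne h.symm
        · exact hs'_ne h.symm
      have hf₁ : f ≠ e₁ := fun h => hbf (by rw [h, h₁]; exact Sym2.mem_mk_left _ _)
      have hf₂ : f ≠ e₂ := fun h => hbf (by rw [h, h₂]; exact Sym2.mem_mk_left _ _)
      have hf' : y₂ f = true := by rw [← hy f hf₁ hf₂]; exact hf
      exact conn_trans hs (conn_of_openAdj ⟨f, hf', hends⟩)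
    exact key
  · exact conn_mono hle

/-- **The mark slides along a degree-two vertex at its own root, modulo typed BHK 1.3**
(THEOREM L): if the mark `b` has exactly the two free edges `e₁ = b a₁` and `e₂ = b x`, then
`D(G; a₁, a₂, b, o) = D(G − b; a₁, a₂, x, o) + S₁₃(G − b; a₂; x, o)`,
the last term being the two-copy count of the typed BHK 1.3 kernel `foldK13`. -/
theorem pairCount_foldK_slide_own (he : e₁ ≠ e₂) (h₁ : ends e₁ = s(b, a₁))
    (h₂ : ends e₂ = s(b, x)) (hba₁ : b ≠ a₁) (hbx : b ≠ x)
    (hb : ∀ f, b ∈ ends f → f = e₁ ∨ f = e₂) (ha₂ : a₂ ≠ b) (ho : o ≠ b)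
    (F : Finset E) (z : Config E) (h₁F : e₁ ∈ F) (h₂F : e₂ ∈ F) :
    pairCount F z (foldK ends a₁ a₂ b o : Config E → Config E → R) =
      pairCount ((F.erase e₂).erase e₁) (Function.update (Function.update z e₂ false) e₁ false)
          (foldK ends a₁ a₂ x o) +
        pairCount ((F.erase e₂).erase e₁) (Function.update (Function.update z e₂ false) e₁ false)
          (foldK13 ends a₁ a₂ x o) := by
  classical
  set F' := F.erase e₂ with hF'
  set z' := Function.update z e₂ false with hz'
  set F'' := F'.erase e₁ with hF''
  set z'' := Function.update z' e₁ false with hz''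
  have h₁F' : e₁ ∈ F' := Finset.mem_erase.2 ⟨he, h₁F⟩
  have hb₁ : ∀ f, b ∈ ends f → f ≠ e₁ → f = e₂ := fun f hf hf₁ => (hb f hf).resolve_left hf₁
  have hb₂ : ∀ f, b ∈ ends f → f ≠ e₂ → f = e₁ := fun f hf hf₂ => (hb f hf).resolve_right hf₂
  have ha₁ : a₁ ≠ b := hba₁.symm
  -- the flipped second copy of `F` agrees with that of `F''` off `e₁, e₂`
  have hflip_off : ∀ (y : Config E) (f : E), f ≠ e₁ → f ≠ e₂ →
      A3InactiveTyped.flipOn F y f = A3InactiveTyped.flipOn F'' y f := by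
    intro y f hf₁ hf₂
    by_cases hfF : f ∈ F
    · rw [A3InactiveTyped.flipOn_of_mem hfF,
        A3InactiveTyped.flipOn_of_mem (Finset.mem_erase.2 ⟨hf₁, Finset.mem_erase.2 ⟨hf₂, hfF⟩⟩)]
    · rw [A3InactiveTyped.flipOn_of_notMem hfF,
        A3InactiveTyped.flipOn_of_notMem (fun h => hfF
          (Finset.mem_of_mem_erase (Finset.mem_of_mem_erase h)))]
  have hflip''₁ : ∀ y : Config E, A3InactiveTyped.flipOn F'' y e₁ = y e₁ := fun y =>
    A3InactiveTyped.flipOn_of_notMem (Finset.notMem_erase e₁ F')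
  have hflip''₂ : ∀ y : Config E, A3InactiveTyped.flipOn F'' y e₂ = y e₂ := fun y =>
    A3InactiveTyped.flipOn_of_notMem (fun h => Finset.notMem_erase e₂ F (Finset.mem_of_mem_erase h))
  -- the counting: split on `e₂`, then on `e₁`
  unfold pairCount
  rw [sum_admissible_split h₂F, ← hF', ← hz', sum_admissible_split h₁F', ← hF'', ← hz'']
  have hzero := pairCount_foldK0 ends a₁ a₂ o F'' z'' (R := R)
  unfold pairCount at hzero
  have hrhs : (∑ y : Config E, if (∀ f, f ∉ F'' → y f = z'' f) then
        (foldK ends a₁ a₂ x o y (A3InactiveTyped.flipOn F'' y) : R) else 0) +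
      (∑ y : Config E, if (∀ f, f ∉ F'' → y f = z'' f) then
        (foldK13 ends a₁ a₂ x o y (A3InactiveTyped.flipOn F'' y) : R) else 0) =
      ∑ y : Config E, if (∀ f, f ∉ F'' → y f = z'' f) then
        (foldK ends a₁ a₂ x o y (A3InactiveTyped.flipOn F'' y) +
          foldK13 ends a₁ a₂ x o y (A3InactiveTyped.flipOn F'' y) +
          2 * foldK0 ends a₁ a₂ o y (A3InactiveTyped.flipOn F'' y) : R) else 0 := by
    have hsplit : ∀ y : Config E, (if (∀ f, f ∉ F'' → y f = z'' f) then
        (foldK ends a₁ a₂ x o y (A3InactiveTyped.flipOn F'' y) +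
          foldK13 ends a₁ a₂ x o y (A3InactiveTyped.flipOn F'' y) +
          2 * foldK0 ends a₁ a₂ o y (A3InactiveTyped.flipOn F'' y) : R) else 0) =
        (if (∀ f, f ∉ F'' → y f = z'' f) then
          (foldK ends a₁ a₂ x o y (A3InactiveTyped.flipOn F'' y) : R) else 0) +
        (if (∀ f, f ∉ F'' → y f = z'' f) then
          (foldK13 ends a₁ a₂ x o y (A3InactiveTyped.flipOn F'' y) : R) else 0) +
        2 * (if (∀ f, f ∉ F'' → y f = z'' f) then
          (foldK0 ends a₁ a₂ o y (A3InactiveTyped.flipOn F'' y) : R) else 0) := by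
      intro y
      split_ifs <;> ring
    simp_rw [hsplit]
    rw [Finset.sum_add_distrib, Finset.sum_add_distrib, ← Finset.mul_sum, hzero, mul_zero, add_zero]
  rw [hrhs]
  refine Finset.sum_congr rfl fun y₂ _ => ?_
  by_cases hadm : ∀ f, f ∉ F'' → y₂ f = z'' f
  · rw [if_pos hadm, if_pos hadm]
    have hy₂₁ : y₂ e₁ = false := by
      have := hadm e₁ (Finset.notMem_erase e₁ F')
      rwa [hz'', Function.update_self] at this
    have hy₂₂ : y₂ e₂ = false := by
      have := hadm e₂ (fun h => Finset.notMem_erase e₂ F (Finset.mem_of_mem_erase h))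
      rwa [hz'', Function.update_of_ne he.symm, hz', Function.update_self] at this
    have hiso : ∀ f, b ∈ ends f → y₂ f = false := by
      intro f hf
      rcases hb f hf with rfl | rfl
      · exact hy₂₁
      · exact hy₂₂
    have hself₁ : Function.update y₂ e₁ false = y₂ := by
      rw [← hy₂₁]; exact Function.update_eq_self e₁ y₂
    have hself₂ : Function.update y₂ e₂ false = y₂ := by
      rw [← hy₂₂]; exact Function.update_eq_self e₂ y₂
    have hself₂' : Function.update (Function.update y₂ e₁ true) e₂ false =
        Function.update y₂ e₁ true := by
      have : Function.update y₂ e₁ true e₂ = false := by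
        rw [Function.update_of_ne he.symm]; exact hy₂₂
      rw [← this]; exact Function.update_eq_self e₂ _
    rw [hself₁, hself₂, hself₂']
    set w₂ := A3InactiveTyped.flipOn F'' y₂ with hw₂
    -- (A) both closed: `b` isolated in the first copy
    have hA : (foldK ends a₁ a₂ b o y₂ (A3InactiveTyped.flipOn F y₂) : R) = 0 :=
      foldK_eq_zero_of_not_conn (not_conn_isolated hiso ha₁)
    -- (B) `e₁` closed, `e₂` open: the mark moves to `x`
    have hB : (foldK ends a₁ a₂ b o (Function.update y₂ e₂ true)
        (A3InactiveTyped.flipOn F (Function.update y₂ e₂ true)) : R) =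
        foldK ends a₁ a₂ x o y₂ w₂ := by
      set y := Function.update y₂ e₂ true with hy
      set w := A3InactiveTyped.flipOn F y with hw
      have hy₂ : y e₂ = true := Function.update_self _ _ _
      have hy₁ : y e₁ = false := by rw [hy, Function.update_of_ne he]; exact hy₂₁
      have hyback : Function.update y e₂ false = y₂ := by
        rw [hy, Function.update_idem, ← hy₂₂]; exact Function.update_eq_self e₂ y₂
      have hleafy : ∀ f, b ∈ ends f → f ≠ e₂ → y f = false := by
        intro f hf hf₂
        rw [hb₂ f hf hf₂]; exact hy₁
      have hw₁ : w e₁ = true := by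
        rw [hw, A3InactiveTyped.flipOn_of_mem h₁F, hy₁]; rfl
      have hw₂' : w e₂ = false := by
        rw [hw, A3InactiveTyped.flipOn_of_mem h₂F, hy₂]; rfl
      have hleafw : ∀ f, b ∈ ends f → f ≠ e₁ → w f = false := by
        intro f hf hf₁
        rw [hb₁ f hf hf₁]; exact hw₂'
      have hwback : Function.update w e₁ false = w₂ := by
        funext f
        by_cases hf₁ : f = e₁
        · subst hf₁
          rw [Function.update_self, hw₂, hflip''₁]; exact hy₂₁.symm
        by_cases hf₂ : f = e₂
        · subst hf₂
          rw [Function.update_of_ne hf₁, hw₂', hw₂, hflip''₂]; exact hy₂₂.symm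
        · rw [Function.update_of_ne hf₁, hw, hw₂, hflip_off y f hf₁ hf₂]
          by_cases hfF : f ∈ F''
          · rw [A3InactiveTyped.flipOn_of_mem hfF, A3InactiveTyped.flipOn_of_mem hfF, hy,
              Function.update_of_ne hf₂]
          · rw [A3InactiveTyped.flipOn_of_notMem hfF, A3InactiveTyped.flipOn_of_notMem hfF, hy,
              Function.update_of_ne hf₂]
      refine foldK_congr_mark ha₁ ha₂ ho ?_ ?_ ?_
      · intro t t' ht ht'
        rw [conn_leaf_erase h₂ hbx hleafy hy₂ ht ht', hyback]
      · intro t t' ht ht'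
        rw [conn_leaf_erase h₁ hba₁ hleafw hw₁ ht ht', hwback]
      · rw [conn_mark_leaf h₂ hbx hleafy hy₂ ha₁, hyback]
    -- (C) `e₁` open, `e₂` closed: `b ∈ C_y(a₁)`, a spectator leaf in both copies
    have hC : (foldK ends a₁ a₂ b o (Function.update y₂ e₁ true)
        (A3InactiveTyped.flipOn F (Function.update y₂ e₁ true)) : R) =
        foldK0 ends a₁ a₂ o y₂ w₂ := by
      set y := Function.update y₂ e₁ true with hy
      set w := A3InactiveTyped.flipOn F y with hw
      have hy₁ : y e₁ = true := Function.update_self _ _ _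
      have hy₂ : y e₂ = false := by rw [hy, Function.update_of_ne he.symm]; exact hy₂₂
      have hyback : Function.update y e₁ false = y₂ := by
        rw [hy, Function.update_idem, ← hy₂₁]; exact Function.update_eq_self e₁ y₂
      have hleafy : ∀ f, b ∈ ends f → f ≠ e₁ → y f = false := by
        intro f hf hf₁
        rw [hb₁ f hf hf₁]; exact hy₂
      have hw₁ : w e₁ = false := by
        rw [hw, A3InactiveTyped.flipOn_of_mem h₁F, hy₁]; rfl
      have hw₂' : w e₂ = true := by
        rw [hw, A3InactiveTyped.flipOn_of_mem h₂F, hy₂]; rfl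
      have hleafw : ∀ f, b ∈ ends f → f ≠ e₂ → w f = false := by
        intro f hf hf₂
        rw [hb₂ f hf hf₂]; exact hw₁
      have hwback : Function.update w e₂ false = w₂ := by
        funext f
        by_cases hf₂ : f = e₂
        · subst hf₂
          rw [Function.update_self, hw₂, hflip''₂]; exact hy₂₂.symm
        by_cases hf₁ : f = e₁
        · subst hf₁
          rw [Function.update_of_ne hf₂, hw₁, hw₂, hflip''₁]; exact hy₂₁.symm
        · rw [Function.update_of_ne hf₂, hw, hw₂, hflip_off y f hf₁ hf₂]
          by_cases hfF : f ∈ F''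
          · rw [A3InactiveTyped.flipOn_of_mem hfF, A3InactiveTyped.flipOn_of_mem hfF, hy,
              Function.update_of_ne hf₁]
          · rw [A3InactiveTyped.flipOn_of_notMem hfF, A3InactiveTyped.flipOn_of_notMem hfF, hy,
              Function.update_of_ne hf₁]
      have hcb : Conn ends y a₁ b := conn_symm (conn_of_openAdj ⟨e₁, hy₁, h₁⟩)
      have hQy : Conn ends y a₁ a₂ ↔ Conn ends y₂ a₁ a₂ := by
        rw [conn_leaf_erase h₁ hba₁ hleafy hy₁ ha₁ ha₂, hyback]
      have hHy : Conn ends y a₂ o ↔ Conn ends y₂ a₂ o := by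
        rw [conn_leaf_erase h₁ hba₁ hleafy hy₁ ha₂ ho, hyback]
      have hQw : Conn ends w a₁ a₂ ↔ Conn ends w₂ a₁ a₂ := by
        rw [conn_leaf_erase h₂ hbx hleafw hw₂' ha₁ ha₂, hwback]
      have hHw : Conn ends w a₂ o ↔ Conn ends w₂ a₂ o := by
        rw [conn_leaf_erase h₂ hbx hleafw hw₂' ha₂ ho, hwback]
      simp only [foldK, foldK0, iQ_eq_ite', iL_eq_ite', iH_eq_ite', hQy, hHy, hQw, hHw, if_pos hcb]
      ring
    -- (D) both open: the path `a₁ – b – x`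
    have hD : (foldK ends a₁ a₂ b o (Function.update (Function.update y₂ e₁ true) e₂ true)
        (A3InactiveTyped.flipOn F (Function.update (Function.update y₂ e₁ true) e₂ true)) : R) =
        foldK0 ends a₁ a₂ o y₂ w₂ + foldK13 ends a₁ a₂ x o y₂ w₂ := by
      set y := Function.update (Function.update y₂ e₁ true) e₂ true with hy
      set w := A3InactiveTyped.flipOn F y with hw
      have hy₂ : y e₂ = true := Function.update_self _ _ _
      have hy₁ : y e₁ = true := by
        rw [hy, Function.update_of_ne he, Function.update_self]
      have hyoff : ∀ f, f ≠ e₁ → f ≠ e₂ → y f = y₂ f := by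
        intro f hf₁ hf₂
        rw [hy, Function.update_of_ne hf₂, Function.update_of_ne hf₁]
      have hweq : w = w₂ := by
        funext f
        by_cases hf₂ : f = e₂
        · subst hf₂
          rw [hw, A3InactiveTyped.flipOn_of_mem h₂F, hy₂, hw₂, hflip''₂, hy₂₂]; rfl
        by_cases hf₁ : f = e₁
        · subst hf₁
          rw [hw, A3InactiveTyped.flipOn_of_mem h₁F, hy₁, hw₂, hflip''₁, hy₂₁]; rfl
        · rw [hw, hw₂, hflip_off y f hf₁ hf₂]
          by_cases hfF : f ∈ F''
          · rw [A3InactiveTyped.flipOn_of_mem hfF, A3InactiveTyped.flipOn_of_mem hfF,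
              hyoff f hf₁ hf₂]
          · rw [A3InactiveTyped.flipOn_of_notMem hfF, A3InactiveTyped.flipOn_of_notMem hfF,
              hyoff f hf₁ hf₂]
      have hcb : Conn ends y a₁ b := conn_symm (conn_of_openAdj ⟨e₁, hy₁, h₁⟩)
      have hQy : Conn ends y a₁ a₂ ↔ Conn ends y₂ a₁ a₂ ∨ Conn ends y₂ a₂ x := by
        rw [conn_root_path h₁ h₂ hy₁ hy₂ hyoff hiso ha₂]
        exact or_congr_right ⟨conn_symm, conn_symm⟩
      rw [hweq]
      simp only [foldK, foldK0, foldK13, iQ_eq_ite', iL_eq_ite', iH_eq_ite', if_pos hcb]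
      by_cases hQ : Conn ends y a₁ a₂
      · rw [if_pos hQ]
        rcases hQy.1 hQ with h | h
        · rw [if_pos h]; ring
        · rw [if_pos h]
          by_cases h' : Conn ends y₂ a₁ a₂
          · rw [if_pos h']; ring
          · rw [if_neg h']; ring
      · rw [if_neg hQ]
        have hQ' : ¬ Conn ends y₂ a₁ a₂ := fun h => hQ (hQy.2 (Or.inl h))
        have hx' : ¬ Conn ends y₂ a₂ x := fun h => hQ (hQy.2 (Or.inr h))
        have hHy : Conn ends y a₂ o ↔ Conn ends y₂ a₂ o :=
          conn_other_root_path h₁ h₂ hy₁ hyoff hiso hQ ha₂ ho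
        rw [if_neg hQ', if_neg hx', hHy]
        ring
    rw [hA, hB, hC, hD]
    ring
  · rw [if_neg hadm, if_neg hadm]

end SlideOwn

end TB14Cut

end Summit.Ventures.PercRepro2
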